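import Literature.NumberTheory.GaloisRepresentations.HochschildSerreLowDegree
import HarnessLib

/-!
# T-42-mult in the kernel, XXXIII: `res : H¹(G, M) → H¹(N, M)^{G/N}` is ONTO the invariant classes when
# `H²(G/N, M^N) = 0` — the surjectivity half of inflation–restriction, discrete coefficients (generic brick of `T2`)

Cell `bsd-2adic` (run/shared/lean/pub/bsd-2adic/), seat `bsd-2adic-t42` (BRIEF-T42), GEN 17. HONEST FRAMING:
research route; THEOREMS ONLY (no `def`, no named fact, no instance); generic profinite group cohomology, nothing
about any curve; nothing booked; BSD is not proved by any of this. PARTITION: X5@2 multiplicative GV-transport rows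
(K4ᵐ B1·O1; the LOCAL statement `T2` at `2`, last open input of `hF3b` after XXX) × p = 2 — types-the-object-of;
bears_on K4 items 19922 / 19923 (`--supports stmt-BirchSwinnertonDyer-19923`).

## What

For a profinite group `G`, a closed normal subgroup `N` and a discrete `G`-module `M` with `H²(G/N, M^N) = 0`,
every `G`-invariant class of `H¹(N, M)` is restricted from `G`
(`exists_resSubgroup_eq_of_forall_conjMap_eq_of_subsingleton_two`). The tree proves this NUMERICALLY
(`HochschildSerreLowDegree.natCard_one_eq_mul`: `#H¹(G, M) = #H¹(G/N, M^N) · #H¹(N, M)^{G/N}`, via the coinduced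
dimension shift) and for FREE PROCYCLIC quotients by explicit extension
(`HOneRestrictionOntoInvariants(Finite)`); `T2` needs the element form for the `ℤ_2`-QUOTIENT
`Γ_{ℚ_2} / Gal(ℚ̄_2/ℚ_{2,∞})` (`cd_2(ℤ_2) = 1`: `PadicIntCdOne.groupCdLE_one_quotient_ker_of_surjective`), where
the quotient is not free procyclic. This file extracts the element form from the proof of `natCard_one_eq_mul`
(same dimension shift: `0 → M → C(G, M) → Q → 0`, `H¹(N, C(G,M)) = H¹(G/N, C(G,M)^N) = 0`, so an invariant class is
`δ_N q` for a `G`-invariant `q ∈ Q^N`, and `res (δ₀ q) = δ_N q`).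

References: [SerreGaloisCohomology1997] I §2.6 (b); [NeukirchSchmidtWingberg2008] (1.6.7); [Shatz1972] II §1–2.
-/

set_option autoImplicit false
set_option linter.dupNamespace false

noncomputable section

open CategoryTheory Function

universe u

namespace Summit.BirchSwinnertonDyer.BirchSwinnertonDyer.Theorems.MultTransportTwistedDescent

open Literature.NumberTheory.GaloisRepresentations ContinuousCohomology

variable {G : Type u} [Group G] [TopologicalSpace G] [IsTopologicalGroup G] [CompactSpace G] [T2Space G]
  [TotallyDisconnectedSpace G]
variable (N : Subgroup G) [N.Normal] [hN : IsClosed (N : Set G)]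
variable {M : Type u} [AddCommGroup M] [TopologicalSpace M] [DiscreteTopology M]
variable (ρ : ContinuousRep G ℤ M)

/-- **`res : H¹(G, M) → H¹(N, M)` is onto the `G`-invariant classes when `H²(G/N, M^N) = 0`** (`G` profinite,
`N` closed normal, `M` discrete): exactness of `0 → H¹(G/N, M^N) → H¹(G, M) → H¹(N, M)^{G/N} → H²(G/N, M^N)`
on the right. Element form of the tree's `HochschildSerreLowDegree.natCard_one_eq_mul` (same proof: coinduced
dimension shift). [cite: SerreGaloisCohomology1997, I §2.6 (b)] [cite: NeukirchSchmidtWingberg2008, (1.6.7)] -/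
theorem exists_resSubgroup_eq_of_forall_conjMap_eq_of_subsingleton_two
    [Subsingleton (continuousCohomology 2 (ρ.quotientInvariants N).toTopRep)]
    (yc : continuousCohomology 1 ((ρ.restrict (subgroupIncl N)).toTopRep))
    (hinv : ∀ g : G, conjMap ρ.toTopRep N g 1 yc = yc) :
    ∃ xc : continuousCohomology 1 ρ.toTopRep, resSubgroup ρ.toTopRep N 1 xc = yc := by
  haveI := subsingleton_coind_restrict N ρ 0
  haveI := subsingleton_coind_invariants N ρ 0
  have h := isSES_coind ρ
  haveI := subsingleton_one_imRep N h
  have hXQT := isSES_deltaNHom N h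
  have hy' : HOne.of N ρ yc ∈ (hOneRep N ρ).toTopRep.ρ.invariants :=
    (mem_invariants_hOneRep_iff N ρ _).2 hinv
  obtain ⟨q, hq, hqy⟩ := (hXQT.δ₀_eq_zero_iff ⟨HOne.of N ρ yc, hy'⟩).1 (Subsingleton.elim _ _)
  have hqG : q.1 ∈ ρ.coindQuot.toTopRep.ρ.invariants := fun a => by
    have := congrArg Subtype.val (hq (QuotientGroup.mk a))
    exact this
  have e := resSubgroup_δ₀ N h q.1 hqG q.2
  refine ⟨h.δ₀ ⟨q.1, hqG⟩, e.trans ?_⟩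
  exact ((HOne.of N ρ).symm_apply_apply _).symm.trans (congrArg (HOne.of N ρ).symm hqy)

end Summit.BirchSwinnertonDyer.BirchSwinnertonDyer.Theorems.MultTransportTwistedDescent

end
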